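import Literature.NumberTheory.GaloisRepresentations.IdeleClassBarSRelativeLayers
import Literature.NumberTheory.GaloisRepresentations.GalLayerSystemSubgroupLayers
import HarnessLib

/-!
# Every open normal subgroup of `G_S` IS a layer subgroup `V̄_L = Gal(K_S/L)`, and the image of `V̄_L` in `Gal(E/K)` is the
# image of `U_L = Gal(K̄/L)` — the template's `H_E = subgroupImage U_L E` (Serre I §2.2 Prop. 8; NSW VIII §3)

Topic `NumberTheory/GaloisRepresentations`; namespace `Literature.NumberTheory.GaloisRepresentations.IdeleClassBar`.  Theorems only
(no definition, no named fact, no instance, no notation, no `sorry`).  Two dictionary lemmas between bsd-line-x1-p1-w3 g17's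
`S`-layers (`layerSubgroupS S L ≤ G_S`, `restrictHomS`, `subgroupImageS`) and the template's layers of `Γ_K` (door-c5/door-c6:
`GalLayer.ofOpenNormalSubgroup`, `GalLayer.subgroupImage`), used by the D2-(b) assembly (`adjointBijective_one_zmod_pow` for
`(G_S, C̄_S)`, the S-port of door-c4 g16/g17's `IdeleClassBarModAlphaOne*`):

* **`exists_layerSubgroupS_eq`** — every `U : OpenNormalSubgroup G_S` is `layerSubgroupS S L` for the layer `L = K̄^{Ũ}` of its
  preimage `Ũ ≤ Γ_K` (which contains `N_S`, so `L ⊆ K_S`): the engine's `∀ U` becomes `∀ L ⊆ K_S` ON THE NOSE (`obtain ⟨L, hL, rfl⟩`).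
* **`subgroupImageS_layerSubgroupS_eq_subgroupImage`** — `subgroupImageS S hE (layerSubgroupS S L) = GalLayer.subgroupImage ↑L.openNormalSubgroup E`
  as subgroups of `Gal(E/K)`: the relative layers of `(↥V̄_L, Res C̄_S)` are read in the SAME subgroups `H_E ≤ Gal(E/K)` as the
  template's relative layers of `(U_L, Res C̄)`, so door-c6's `invSub_apply_eq_classInvAll` / door-c4 g16's `galEquivSubgroupImage`
  apply to them verbatim.

Cell `bsd-eis`, background lane «PT-Ш-S-TC» of crux `GoodLatticeBDPValue` (stmt-BirchSwinnertonDyer-19032), brick D2-(b), seat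
bsd-line-x1-p1-w8 g12.  HONEST FRAMING: group-theoretic plumbing; nothing about BSD / Poitou–Tate is proved.

## References
* J.-P. Serre, *Galois Cohomology* (1997), I §2.2 Proposition 8. [SerreGaloisCohomology1997]
* J. Neukirch, A. Schmidt, K. Wingberg, *Cohomology of Number Fields*, 2nd ed. (2008), VIII §3. [NeukirchSchmidtWingberg2008]
-/

noncomputable section

open NumberField IsDedekindDomain
open Field (absoluteGaloisGroup)
open Literature.NumberTheory.GaloisRepresentations.LocalWeilDatum (galFixing mem_galFixing_iff)

namespace Literature.NumberTheory.GaloisRepresentations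

namespace IdeleClassBar

variable {K : Type} [Field K] [NumberField K] (S : Finset (HeightOneSpectrum (𝓞 K)))

/-- **Every open normal subgroup of `G_S` is a layer subgroup `V̄_L`** of a layer `L ⊆ K_S`: with `Ũ ≤ Γ_K` the preimage of `U`
(open, normal, `⊇ N_S`) and `L := K̄^{Ũ}`, `V̄_L = Ũ N_S ⧸ N_S = U`. [cite: SerreGaloisCohomology1997, I §2.2 Proposition 8]
[cite: NeukirchSchmidtWingberg2008, VIII §3] -/
theorem exists_layerSubgroupS_eq (U : OpenNormalSubgroup (GaloisGroupUnramifiedOutside K (↑S : Set (HeightOneSpectrum (𝓞 K))))) :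
    ∃ (L : GalLayer K) (_ : ramificationSubgroup K (↑S : Set (HeightOneSpectrum (𝓞 K))) ≤ galFixing K L.1),
      layerSubgroupS S L = U := by
  let π := QuotientGroup.mk' (ramificationSubgroup K (↑S : Set (HeightOneSpectrum (𝓞 K))))
  -- the preimage `Ũ` of `U` in `Γ_K`, as an open normal subgroup
  have hopen : IsOpen (((U : Subgroup _).comap π : Subgroup (absoluteGaloisGroup K)) : Set (absoluteGaloisGroup K)) :=
    U.toOpenSubgroup.isOpen.preimage (continuous_toUnramifiedQuot K _)
  let V : OpenNormalSubgroup (absoluteGaloisGroup K) :=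
    { toSubgroup := (U : Subgroup _).comap π
      isOpen' := hopen
      isNormal' := Subgroup.Normal.comap inferInstance π }
  have hV : (V : Subgroup (absoluteGaloisGroup K)) = (U : Subgroup _).comap π := rfl
  refine ⟨GalLayer.ofOpenNormalSubgroup V, ?_, ?_⟩
  · -- `N_S = ker π ≤ Ũ`
    rw [galFixing_eq_coe_openNormalSubgroup, GalLayer.openNormalSubgroup_ofOpenNormalSubgroup, hV]
    intro σ hσ
    have h1 : π σ = 1 := (QuotientGroup.eq_one_iff σ).mpr hσ
    change π σ ∈ (U : Subgroup _)
    rw [h1]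
    exact one_mem _
  · apply OpenNormalSubgroup.toSubgroup_injective
    change (layerSubgroupS S (GalLayer.ofOpenNormalSubgroup V) : Subgroup (GaloisGroupUnramifiedOutside K (↑S : Set (HeightOneSpectrum (𝓞 K))))) =
      (U : Subgroup (GaloisGroupUnramifiedOutside K (↑S : Set (HeightOneSpectrum (𝓞 K)))))
    rw [coe_layerSubgroupS, galFixing_eq_coe_openNormalSubgroup, GalLayer.openNormalSubgroup_ofOpenNormalSubgroup, hV]
    exact Subgroup.map_comap_eq_self_of_surjective (QuotientGroup.mk'_surjective _) _

/-- **`H_E` for `W = V̄_L` is the template's `subgroupImage U_L E`**: the image of `V̄_L = Gal(K_S/L)` under `[σ] ↦ σ|_E` equals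
the image of `U_L = Gal(K̄/L)` under `σ ↦ σ|_E` (both are `Gal(E/L) ≤ Gal(E/K)` when `L ≤ E`).
[cite: SerreGaloisCohomology1997, I §2.2 Proposition 8] -/
theorem subgroupImageS_layerSubgroupS_eq_subgroupImage {E : GalLayer K}
    (hE : ramificationSubgroup K (↑S : Set (HeightOneSpectrum (𝓞 K))) ≤ galFixing K E.1) (L : GalLayer K) :
    subgroupImageS S hE (layerSubgroupS S L : Subgroup _) =
      GalLayer.subgroupImage (L.openNormalSubgroup : Subgroup (absoluteGaloisGroup K)) E := by
  change ((galFixing K L.1).map _).map (restrictHomS S hE) = (L.openNormalSubgroup : Subgroup (absoluteGaloisGroup K)).map E.restrictHom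
  rw [Subgroup.map_map, galFixing_eq_coe_openNormalSubgroup]
  exact congrArg (fun f => Subgroup.map f _) (MonoidHom.ext fun σ => restrictHomS_mk S hE σ)

end IdeleClassBar

end Literature.NumberTheory.GaloisRepresentations

end
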